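import Summits.ValiantsHypothesis.ValiantsHypothesis.Theorems.BarrierLeverPartitionMinorsPairSplit

/-!
# Route BarrierLever — Chow witnesses for partition minors (items 20172 / 20195): the RANK-ONE PEEL
# (reduction R3a) — deleting one `x`-coordinate and one `y`-coordinate

Helper file (`--supports stmt-ValiantsHypothesis-20172`; cell valiant-natproofs, rung V4, 𝒟-side of
door (c); seat val-np-p4 gen 11; planner valiant-natproofs-p1 g15's MEMO-normalforms §4, rule R3a).
Closes NO item.  Conventions of items 19717 / 20172 / 20195: a layout `(u, w)` of height `h` is HIT
when some product of `h + h` affine forms has nonsingular partition minor `det[coeff_{E (u i) (w j)} ∏ ℓ]`.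

**The peel.**  Let `(u, w)` be a layout of height `h + 1` and `a`, `c` coordinates.  If the PEELED
layout of height `h` — delete `a` from every row and `c` from every column and pull back along
`a.succAbove` / `c.succAbove` — is hit, then `(u, w)` is hit (`chow_peel`).  (When two rows differ
exactly in `a`, or two columns exactly in `c`, the peeled layout has two equal rows or columns and
the hypothesis is void; otherwise the peel keeps injectivity and loses nothing.)

Proof: lift the height-`h` witness along the two new coordinates (`…CoordinateLift`) and multiply by
the RANK-ONE gadget `g = (1 + x_a + 2 y_c)(1 + 2 x_a - y_c)`, whose four multilinear coefficients
are `1` (at `1`), `3` (at `x_a`), `1` (at `y_c`), `3` (at `x_a y_c`) — a rank-one table with nonzero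
entries (`coeff_peelGadget`).  By `coeff_partitionExpo_mul_pairFactor` (`…DisjointVariables`) the
partition matrix of `g · F↑` at `(u, w)` is the peeled partition matrix of `F` with row `i` scaled by
`3` if `a ∈ u i` (`Matrix.det_mul_column`).  Compare the literal-pair split `chow_pairSplit`
(gadget with coefficients `1, 0, 0, -2`: block-diagonal, needs equal class sizes) and the lift
`chow_hit_lift` (the case where no row contains `a` and no column contains `c`).

Consequence (file `…ChowBoundedSize`): rows that cannot be peeled at any coordinate span all of
`𝔽₂^h` by differences, so `h ≤ r - 1`; hence CPM for all layouts of SIZE `r ≤ H + 1` at EVERY height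
follows from CPM at heights `≤ H`.

WHAT THIS IS NOT: a reduction step; nothing on items 20172 / 20195 / 19717 themselves (all large `h`),
on crux stmt-ValiantsHypothesis-14610, or on `VP` versus `VNP`.
-/

set_option linter.dupNamespace false

namespace Summit.ValiantsHypothesis.ValiantsHypothesis.Theorems.BarrierLever.ChowFactor

open Finset MvPolynomial

noncomputable section

variable {h : ℕ}

/-! ## 1. The gadget `g = (1 + x_a + 2 y_c)(1 + 2 x_a - y_c)` -/

/-- An affine form in `x_a, y_c` with two coefficients, written as a full affine combination. -/
theorem affine_xy_eq (a c : Fin (h + 1)) (s t : ℂ) :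
    (C 1 + ∑ a' : Fin (h + 1), C (if a' = a then s else 0) * X (Fin.castAdd (h + 1) a') +
        ∑ c' : Fin (h + 1), C (if c' = c then t else 0) * X (Fin.natAdd (h + 1) c') :
      MvPolynomial (Fin ((h + 1) + (h + 1))) ℂ) =
      C 1 + C s * X (Fin.castAdd (h + 1) a) + C t * X (Fin.natAdd (h + 1) c) := by
  rw [Finset.sum_eq_single a, Finset.sum_eq_single c, if_pos rfl, if_pos rfl]
  · intro c' _ hc'
    rw [if_neg hc', C_0, zero_mul]
  · intro hc
    exact absurd (Finset.mem_univ c) hc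
  · intro a' _ ha'
    rw [if_neg ha', C_0, zero_mul]
  · intro ha
    exact absurd (Finset.mem_univ a) ha

/-- The gadget's factors have total degree `≤ 1`. -/
theorem totalDegree_affine_xy_le (a c : Fin (h + 1)) (s t : ℂ) :
    (C 1 + C s * X (Fin.castAdd (h + 1) a) + C t * X (Fin.natAdd (h + 1) c) :
      MvPolynomial (Fin ((h + 1) + (h + 1))) ℂ).totalDegree ≤ 1 := by
  refine (totalDegree_add _ _).trans (max_le ((totalDegree_add _ _).trans (max_le ?_ ?_)) ?_)
  · rw [totalDegree_C]
    exact Nat.zero_le _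
  · refine (totalDegree_mul _ _).trans ?_
    rw [totalDegree_C, totalDegree_X, zero_add]
  · refine (totalDegree_mul _ _).trans ?_
    rw [totalDegree_C, totalDegree_X, zero_add]

/-- An affine form in `x_a, y_c` involves only these two variables. -/
theorem vars_affine_xy_subset (a c : Fin (h + 1)) (s t : ℂ) :
    (C 1 + C s * X (Fin.castAdd (h + 1) a) + C t * X (Fin.natAdd (h + 1) c) :
      MvPolynomial (Fin ((h + 1) + (h + 1))) ℂ).vars ⊆ {Fin.castAdd (h + 1) a, Fin.natAdd (h + 1) c} := by
  classical
  refine (vars_add_subset _ _).trans (Finset.union_subset ((vars_add_subset _ _).trans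
    (Finset.union_subset ?_ ?_)) ?_)
  · rw [vars_C]
    exact Finset.empty_subset _
  · refine (vars_mul _ _).trans (Finset.union_subset ?_ ?_)
    · rw [vars_C]
      exact Finset.empty_subset _
    · rw [vars_X]
      exact Finset.singleton_subset_iff.mpr (by simp)
  · refine (vars_mul _ _).trans (Finset.union_subset ?_ ?_)
    · rw [vars_C]
      exact Finset.empty_subset _
    · rw [vars_X]
      exact Finset.singleton_subset_iff.mpr (by simp)

/-- The peel gadget `(1 + x_a + 2 y_c)(1 + 2 x_a - y_c)` involves only `x_a` and `y_c`. -/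
theorem support_peelGadget (a c : Fin (h + 1)) :
    ∀ m ∈ ((C 1 + C 1 * X (Fin.castAdd (h + 1) a) + C 2 * X (Fin.natAdd (h + 1) c)) *
        (C 1 + C 2 * X (Fin.castAdd (h + 1) a) + C (-1) * X (Fin.natAdd (h + 1) c)) :
        MvPolynomial (Fin ((h + 1) + (h + 1))) ℂ).support,
      ∀ v, ¬ (v = Fin.castAdd (h + 1) a ∨ v = Fin.natAdd (h + 1) c) → m v = 0 := by
  classical
  intro m hm v hv
  by_contra hne
  have hvars : v ∈ ((C 1 + C 1 * X (Fin.castAdd (h + 1) a) + C 2 * X (Fin.natAdd (h + 1) c)) *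
      (C 1 + C 2 * X (Fin.castAdd (h + 1) a) + C (-1) * X (Fin.natAdd (h + 1) c)) :
      MvPolynomial (Fin ((h + 1) + (h + 1))) ℂ).vars :=
    (mem_vars_iff_mem_support v).mpr ⟨m, hm, Finsupp.mem_support_iff.mpr hne⟩
  have hv' := (vars_mul _ _).trans
    (Finset.union_subset (vars_affine_xy_subset a c 1 2) (vars_affine_xy_subset a c 2 (-1))) hvars
  simp only [Finset.mem_insert, Finset.mem_singleton] at hv'
  exact hv hv'

/-- **The four multilinear coefficients of the peel gadget**: `1` at `(∅, ∅)`, `3` at `({a}, ∅)`,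
`1` at `(∅, {c})`, `3` at `({a}, {c})` — a rank-one table with nonzero entries. -/
theorem coeff_peelGadget (a c : Fin (h + 1)) (U W : Finset (Fin (h + 1)))
    (hU : U = ∅ ∨ U = {a}) (hW : W = ∅ ∨ W = {c}) :
    coeff (∑ a' ∈ U, Finsupp.single (Fin.castAdd (h + 1) a') 1 +
        ∑ c' ∈ W, Finsupp.single (Fin.natAdd (h + 1) c') 1)
      ((C 1 + C 1 * X (Fin.castAdd (h + 1) a) + C 2 * X (Fin.natAdd (h + 1) c)) *
        (C 1 + C 2 * X (Fin.castAdd (h + 1) a) + C (-1) * X (Fin.natAdd (h + 1) c)) :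
        MvPolynomial (Fin ((h + 1) + (h + 1))) ℂ) =
      if U = ∅ then 1 else 3 := by
  classical
  rw [← affine_xy_eq a c 2 (-1), coeff_partitionExpo_mul_affine, ← affine_xy_eq a c 1 2,
    coeff_partitionExpo_affine]
  simp_rw [coeff_partitionExpo_affine]
  have hane : ({a} : Finset (Fin (h + 1))) ≠ ∅ := Finset.singleton_ne_empty a
  have hcne : ({c} : Finset (Fin (h + 1))) ≠ ∅ := Finset.singleton_ne_empty c
  rcases hU with rfl | rfl <;> rcases hW with rfl | rfl
  all_goals simp [hane, hcne, Finset.sum_singleton]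
  all_goals norm_num

/-! ## 2. The peel -/

/-- **RANK-ONE PEEL for Chow witnesses (R3a).**  If the peeled layout (delete `a` from the rows and
`c` from the columns, pull back along `succAbove`) of height `h` is hit by a product of `h + h` affine
forms, then `(u, w)` is hit at height `h + 1`. -/
theorem chow_peel (a c : Fin (h + 1)) {r : ℕ} (u w : Fin r → Finset (Fin (h + 1)))
    (hhit : ∃ ℓ : Fin (h + h) → MvPolynomial (Fin (h + h)) ℂ, (∀ q, (ℓ q).totalDegree ≤ 1) ∧
      (Matrix.of fun i j : Fin r => coeff
        (∑ b ∈ (u i).preimage a.succAbove Fin.succAbove_right_injective.injOn,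
            Finsupp.single (Fin.castAdd h b) 1 +
          ∑ d ∈ (w j).preimage c.succAbove Fin.succAbove_right_injective.injOn,
            Finsupp.single (Fin.natAdd h d) 1)
        (∏ q, ℓ q)).det ≠ 0) :
    ∃ ℓ : Fin ((h + 1) + (h + 1)) → MvPolynomial (Fin ((h + 1) + (h + 1))) ℂ,
      (∀ q, (ℓ q).totalDegree ≤ 1) ∧
      (Matrix.of fun i j : Fin r => coeff
        (∑ a' ∈ u i, Finsupp.single (Fin.castAdd (h + 1) a') 1 +
          ∑ c' ∈ w j, Finsupp.single (Fin.natAdd (h + 1) c') 1)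
        (∏ q, ℓ q)).det ≠ 0 := by
  classical
  obtain ⟨ℓ, hdeg, hdet⟩ := hhit
  -- the lift and the two gadget forms
  set L : Fin (h + h) → Fin ((h + 1) + (h + 1)) := Fin.append
    (fun b : Fin h => Fin.castAdd (h + 1) (a.succAbove b))
    (fun d : Fin h => Fin.natAdd (h + 1) (c.succAbove d)) with hL
  set f₁ : MvPolynomial (Fin ((h + 1) + (h + 1))) ℂ :=
    C 1 + C 1 * X (Fin.castAdd (h + 1) a) + C 2 * X (Fin.natAdd (h + 1) c) with hf₁
  set f₂ : MvPolynomial (Fin ((h + 1) + (h + 1))) ℂ :=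
    C 1 + C 2 * X (Fin.castAdd (h + 1) a) + C (-1) * X (Fin.natAdd (h + 1) c) with hf₂
  have hcard : (h + h) + 2 = (h + 1) + (h + 1) := by omega
  set e : Fin ((h + h) + 2) ≃ Fin ((h + 1) + (h + 1)) := finCongr hcard with he
  set ℓ' : Fin ((h + h) + 2) → MvPolynomial (Fin ((h + 1) + (h + 1))) ℂ :=
    Fin.append (fun q => rename L (ℓ q)) ![f₁, f₂] with hℓ'
  refine ⟨fun q => ℓ' (e.symm q), fun q => ?_, ?_⟩
  · show (ℓ' (e.symm q)).totalDegree ≤ 1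
    generalize e.symm q = q₀
    rw [hℓ']
    induction q₀ using Fin.addCases with
    | left q' =>
      rw [Fin.append_left]
      exact totalDegree_rename_le_one L (ℓ q') (hdeg q')
    | right q' =>
      rw [Fin.append_right]
      fin_cases q'
      · exact totalDegree_affine_xy_le a c 1 2
      · exact totalDegree_affine_xy_le a c 2 (-1)
  · -- the product
    have hprod : (∏ q, ℓ' (e.symm q)) = (f₁ * f₂) * rename L (∏ q, ℓ q) := by
      rw [Fintype.prod_equiv e.symm (fun q => ℓ' (e.symm q)) ℓ' (fun _ => rfl), hℓ',
        Fin.prod_univ_add]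
      simp only [Fin.append_left, Fin.append_right, Fin.prod_univ_two, Matrix.cons_val_zero,
        Matrix.cons_val_one]
      rw [map_prod, mul_comm]
    rw [hprod]
    -- entries of the partition matrix: the peeled entries, row `i` scaled by `3` if `a ∈ u i`
    have hentry : ∀ i j : Fin r, coeff
        (∑ a' ∈ u i, Finsupp.single (Fin.castAdd (h + 1) a') 1 +
          ∑ c' ∈ w j, Finsupp.single (Fin.natAdd (h + 1) c') 1) ((f₁ * f₂) * rename L (∏ q, ℓ q)) =
        (if u i ∩ {a} = ∅ then (1 : ℂ) else 3) *
        coeff (∑ b ∈ (u i).preimage a.succAbove Fin.succAbove_right_injective.injOn,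
            Finsupp.single (Fin.castAdd h b) 1 +
          ∑ d ∈ (w j).preimage c.succAbove Fin.succAbove_right_injective.injOn,
            Finsupp.single (Fin.natAdd h d) 1) (∏ q, ℓ q) := by
      intro i j
      rw [coeff_partitionExpo_mul_pairFactor _ _ a c (support_peelGadget a c)
        (support_rename_lift a c _) (u i) (w j)]
      have hfa : (u i).filter (fun a' => a' = a) = u i ∩ {a} := by
        ext x; simp [Finset.mem_filter, Finset.mem_inter]
      have hfc : (w j).filter (fun c' => c' = c) = w j ∩ {c} := by
        ext x; simp [Finset.mem_filter, Finset.mem_inter]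
      rw [hfa, hfc, coeff_peelGadget a c _ _ ?_ ?_, erase_eq_map_preimage_succAbove,
        erase_eq_map_preimage_succAbove, coeff_lift_rename]
      · by_cases ha : a ∈ u i
        · right; rw [Finset.inter_singleton_of_mem ha]
        · left; rw [Finset.inter_singleton_of_notMem ha]
      · by_cases hc : c ∈ w j
        · right; rw [Finset.inter_singleton_of_mem hc]
        · left; rw [Finset.inter_singleton_of_notMem hc]
    have hN : (Matrix.of fun i j : Fin r => coeff
        (∑ a' ∈ u i, Finsupp.single (Fin.castAdd (h + 1) a') 1 +
          ∑ c' ∈ w j, Finsupp.single (Fin.natAdd (h + 1) c') 1) ((f₁ * f₂) * rename L (∏ q, ℓ q))) =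
        Matrix.of fun i j : Fin r => (if u i ∩ {a} = ∅ then (1 : ℂ) else 3) *
          (Matrix.of fun i j : Fin r => coeff
            (∑ b ∈ (u i).preimage a.succAbove Fin.succAbove_right_injective.injOn,
                Finsupp.single (Fin.castAdd h b) 1 +
              ∑ d ∈ (w j).preimage c.succAbove Fin.succAbove_right_injective.injOn,
                Finsupp.single (Fin.natAdd h d) 1) (∏ q, ℓ q)) i j := by
      ext i j
      rw [Matrix.of_apply, hentry, Matrix.of_apply, Matrix.of_apply]
    rw [hN, Matrix.det_mul_column]
    refine mul_ne_zero (Finset.prod_ne_zero_iff.mpr fun i _ => ?_) hdet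
    split_ifs <;> norm_num

end

end Summit.ValiantsHypothesis.ValiantsHypothesis.Theorems.BarrierLever.ChowFactor
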